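import Literature.AnabelianGeometry.EtaleTheta.SettingModelTateDeckDisplayNegOne
import Literature.AnabelianGeometry.EtaleTheta.Discharge.Sec1CompatHolds
import HarnessLib

/-!
# The STAGE-2 («Tate shear») model of [EtTh] §1 (R78), F7q census form: **Prop. 1.5 (iii) is NON-VACUOUSLY SATISFIED**
# — at `modelχq p 1 2`, along the Galois factor `inr`, for the étale-theta datum of the `z`-class `η̈♯ = etaDdχq`

S. Mochizuki, *The étale theta function and its Frobenioid-theoretic manifestations*, Publ. RIMS **45** (2009)
[EtTh], §1, Prop. 1.5 (iii), PRIMS PDF p. 23 [cite: MochizukiEtTh2009, Prop 1.5 (iii) p.23]. Layer L2 of the abc-iut cell,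
seat abc-iut-L2-t6 (gen 6), R78 cluster hand #4, F7q — PROOF-ONLY census closer over part 2c
(`prop15iii_etaleThetaDataOfClass_etaDdχq`, generic in the base section) at the Galois factor `inr` of
`Π^tp_X = Γ ⋊_{actχq} G_{ℚ_p}` (the section hypotheses are discharged INLINE here; abc-iut-L6-d5's named forms
`aug_modelχq_inr` / `map_inr_GK(dd)_le_GtpY(dd)_modelχq` give the same datum by proof irrelevance).

RESULTS: `exists_etaleThetaData_prop15iii_modelχq` — `∃ E : EtaleThetaData(modelχq p 1 2), E.etaDd = etaDdχq ∧ Prop15iii E hC`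
for every `hC`; and the root-level census form `ThetaSetting.exists_isEtThOrigin_and_etaleThetaData_prop15iii` —
SOME theta setting satisfying the guard `IsEtThOrigin` carries an étale-theta datum with `Prop15iii` (at `compat`).
Census token «Prop15iii: WITNESSED at modelχq (Tate shear (κ_p, κ_p²)); REFUTED at the split modelχ (abc-iut-L2-t12)».
HONEST FRAMING: SEMI-SYNTHETIC model — consistency / non-vacuity evidence for the typed interface ONLY; nothing of [EtTh]
is asserted; typed ≠ proved; no side is taken on [IUTchIII] Cor. 3.12.
-/

noncomputable section

namespace Literature.AnabelianGeometry.EtaleTheta.SettingModel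

open Literature.AnabelianGeometry.SemiGraphs _root_.Topology _root_.Function

variable (p : ℕ) [Fact p.Prime]

/-- **Prop. 1.5 (iii) along the Galois factor `inr` at `modelχq p 1 2`**, for the étale-theta datum carrying `η̈♯ = etaDdχq`
over the section Kummer datum of `inr` (section hypotheses discharged inline: `aug ∘ inr = id`, `inr(G_K) ≤ Π^tp_Y`,
`inr(G_K̈) ≤ Π^tp_Ÿ` — trivial `Γ`-part, `K̈ = ℚ_p`). [cite: MochizukiEtTh2009, Prop 1.5 (iii) p.23] -/
theorem prop15iii_etaleThetaDataOfClass_etaDdχq_inr (hC : (ThetaSetting.modelχq p 1 2 even_two).Compat) :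
    ThetaSetting.Prop15iii
      (((kummerCoreχq p 1 2 even_two).toKummerDataOfSection (SemidirectProduct.inr : GQp p →* PiTpχq p 1 2)
        (continuous_inrχq p 1 2) (fun _ => rfl)
        (by
          rintro _ ⟨σ, -, rfl⟩
          show (tateTwistData₀ p 1 2).toZ _ = 1
          rw [GfpTwistData₀.toZ_apply, SemidirectProduct.left_inr, map_one])
        (by
          rintro _ ⟨σ, -, rfl⟩
          refine mem_GtpYdd_modelχq_of_hHat_two_y p 1 2 even_two ?_ ?_
          · show (tateTwistData₀ p 1 2).toZ _ = 1
            rw [GfpTwistData₀.toZ_apply, SemidirectProduct.left_inr, map_one]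
          · rw [SemidirectProduct.left_inr, map_one, map_one, Heis.one_y])).etaleThetaDataOfClass
        (etaDdχq p 1 2 even_two)) hC :=
  prop15iii_etaleThetaDataOfClass_etaDdχq p hC _ _ _ _ _

/-- **CENSUS: Prop. 1.5 (iii) is NON-VACUOUSLY SATISFIED at the stage-2 model** — an étale-theta datum over
`modelχq p 1 2` with `η̈^Θ := etaDdχq` satisfies the typed `Prop15iii` (for every `hC`).
[cite: MochizukiEtTh2009, Prop 1.5 (iii) p.23] -/
theorem exists_etaleThetaData_prop15iii_modelχq (hC : (ThetaSetting.modelχq p 1 2 even_two).Compat) :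
    ∃ E : (ThetaSetting.modelχq p 1 2 even_two).EtaleThetaData,
      E.etaDd = etaDdχq p 1 2 even_two ∧ ThetaSetting.Prop15iii E hC :=
  ⟨_, rfl, prop15iii_etaleThetaDataOfClass_etaDdχq_inr p hC⟩

/-- **Root-level census form**: some theta setting satisfying the guard `IsEtThOrigin` carries an étale-theta datum
satisfying the typed Prop. 1.5 (iii) (witness: the Tate-sheared model `modelχq p 1 2` and the `z`-class `etaDdχq`);
contrast: at the split model `modelχ` the typed Prop. 1.5 (iii) FAILS for every `η̈` over the section datum
(abc-iut-L2-t12's `SettingModelChiProp15iiiSplitNegative`). [cite: MochizukiEtTh2009, Prop 1.5 (iii) p.23] -/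
theorem _root_.Literature.AnabelianGeometry.EtaleTheta.ThetaSetting.exists_isEtThOrigin_and_etaleThetaData_prop15iii :
    ∃ D : ThetaSetting p, D.IsEtThOrigin ∧ ∃ E : D.EtaleThetaData, ThetaSetting.Prop15iii E D.compat :=
  ⟨ThetaSetting.modelχq p 1 2 even_two, ThetaSetting.modelχq_isEtThOrigin p 1 2 even_two, _,
    prop15iii_etaleThetaDataOfClass_etaDdχq_inr p _⟩

end Literature.AnabelianGeometry.EtaleTheta.SettingModel

end
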